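import Mathlib
import Literature.Analysis.FluidPDE.PassiveScalarClassicalEnergy
import Literature.Analysis.FluidPDE.PassiveScalarClassicalWeak
import Summits.AnomalousDissipation.AnomalousDissipation.Theorems.TwoAndHalfDScalarAnomalySteadySourceFormalDuhamelMajorantToolkit
import HarnessLib

/-!
# Joint continuity of the padded classical release kernel (stub F2)

Crux `LimitingAbsorption.FloorUpgrade` (stmt-AnomalousDissipation-15010), line `SketchIdeator1`,
stub `stub_releaseKernelContinuous`. CLASSICAL setting: `φ s` is the classical release of the
smooth profile `h` at time `s ≥ 0`, i.e. a classical solution of `∂ₜφ + u·∇φ = κΔφ` on `[s, ∞)`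
with `φ s s = h`. The lag kernel `k(t, s) = ⟨h, φ_s(t)⟩ = ∫ h · φ s t` (`t ≥ s ≥ 0`) is padded to
all of `ℝ²` through `s⁺ = s ∨ 0`, `t' = t ∨ s⁺`; the padded kernel
`(t, s) ↦ ∫ h · φ_{s⁺}(t ∨ s⁺)` is jointly continuous.

Route. (a) For a classical solution `θ` on `[m, ∞)` and a steady smooth test function `g`,
`d/dt ∫ g θ(t) = ∫ θ(t) (u(t)·∇g + κΔg)` (differentiate under the integral, use the equation,
integrate by parts twice on the torus), whence by Cauchy–Schwarz and the `L²` decay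
`‖θ(t)‖ ≤ ‖θ(m)‖` the pairing `t ↦ ∫ g θ(t)` is Lipschitz on `[m, R]` with constant
`‖θ(m)‖_{L²} G_R`, `G_R²` a bound of `∫ (u(τ)·∇g + κΔg)²` over `τ ∈ [0, R]` — a constant that
does not depend on the release time when `θ(m) = h`. (b) For `0 ≤ s ≤ s' ≤ t` the difference
`φ s - φ s'` is a classical solution on `[s', ∞)`, so
`‖φ_s(t) - φ_{s'}(t)‖² ≤ ‖φ_s(s') - h‖² ≤ 2(⟨h, h⟩ - ⟨h, φ_s(s')⟩) ≤ 2 L (s' - s)` by (a).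
(c) Assemble with Cauchy–Schwarz: on `D = {0 ≤ s ≤ t}` the kernel is continuous
(`|k(t,s) - k(t₀,s₀)| ≤ L|t - t₀| + 2‖h‖√(2L|s - s₀|)` near `(t₀, s₀)`, through the
intermediate release time `s ∧ s₀`), and the padding map `(t, s) ↦ (t ∨ s⁺, s⁺)` is a continuous
retraction of `ℝ²` onto `D`.
-/

set_option linter.dupNamespace false

noncomputable section

open MeasureTheory Set Filter Topology
open scoped BigOperators InnerProductSpace

namespace Summit.AnomalousDissipation.AnomalousDissipation.Theorems.FloorUpgradeLine

namespace ReleaseKernel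

open Literature.Analysis.FunctionSpaces Literature.Analysis.FluidPDE
open Summit.AnomalousDissipation.AnomalousDissipation.Theorems.ScalarAnomalySteadySourceFormal.DuhamelMajorant
open Summit.AnomalousDissipation.AnomalousDissipation.Theorems.ScalarAnomalySteadySourceFormal.ColdStartVariance

variable {d : Type*} [Fintype d] [DecidableEq d]

/-- **Pairing with a steady test function.** For a classical solution `θ` of
`∂ₜθ + u·∇θ = κΔθ`, `div u = 0`, on a convex time set `S` of unique differentiability and a
smooth steady `g`, `d/dt ∫ g θ(t) = ∫ θ(t) (⟪u(t), ∇g⟫ + κΔg)` within `S` (differentiation under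
the integral sign, the equation, and the two integrations by parts
`∫ g ⟪u, ∇θ⟫ = -∫ θ ⟪u, ∇g⟫`, `∫ g Δθ = ∫ θ Δg` on the torus). [folklore] -/
theorem hasDerivWithinAt_integral_mul {S : Set ℝ} {κ : ℝ}
    {u : ℝ → UnitAddTorus d → EuclideanSpace ℝ d} {θ : ℝ → UnitAddTorus d → ℝ}
    {g : UnitAddTorus d → ℝ} (hθ : Torus.IsClassicalScalarTransportOn S κ u θ)
    (hS : Convex ℝ S) (hU : UniqueDiffOn ℝ S) (hg : Torus.IsSmooth g) {t : ℝ} (ht : t ∈ S) :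
    HasDerivWithinAt (fun τ => ∫ x, g x * θ τ x)
      (∫ x, θ t x * (⟪u t x, Torus.gradient g x⟫_ℝ + κ * Torus.laplacian g x)) S t := by
  have hθs := hθ.smooth_scalar
  have hθt : Torus.IsSmooth (θ t) := hθs.isSmooth_slice ht
  have hut : Torus.IsSmooth (u t) := hθ.smooth_velocity.isSmooth_slice ht
  have hG : Torus.IsSmoothSpaceTimeOn S (fun τ x => g x * θ τ x) :=
    (Torus.isSmoothSpaceTimeOn_const hg S).mul hθs
  have hE := hG.hasDerivWithinAt_integral hS ht
  refine hE.congr_deriv ?_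
  have hpt : (fun x => Torus.timeDerivWithin S (fun τ x => g x * θ τ x) t x) = fun x =>
      κ * (g x * Torus.laplacian (θ t) x) - g x * ⟪u t x, Torus.gradient (θ t) x⟫_ℝ := by
    funext x
    have h1 : HasDerivWithinAt (fun τ => g x * θ τ x) (g x * Torus.timeDerivWithin S θ t x) S t :=
      (hθs.hasDerivWithinAt_slice ht x).const_mul (g x)
    rw [Torus.timeDerivWithin, h1.derivWithin (hU t ht)]
    have := hθ.transport t ht x
    have hre : Torus.timeDerivWithin S θ t x =
        κ * Torus.laplacian (θ t) x - ⟪u t x, Torus.gradient (θ t) x⟫_ℝ := by linarith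
    rw [hre]
    ring
  have i1 : Integrable (fun x => g x * Torus.laplacian (θ t) x) volume :=
    (hg.smul' hθt.laplacian).integrable
  have i2 : Integrable (fun x => g x * ⟪u t x, Torus.gradient (θ t) x⟫_ℝ) volume :=
    (hg.smul' (hut.inner hθt.gradient)).integrable
  have j1 : Integrable (fun x => θ t x * ⟪u t x, Torus.gradient g x⟫_ℝ) volume :=
    (hθt.smul' (hut.inner hg.gradient)).integrable
  have j2 : Integrable (fun x => κ * (θ t x * Torus.laplacian g x)) volume :=
    ((hθt.smul' hg.laplacian).integrable).const_mul κ
  -- the two integrations by parts on the torus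
  have hB := Torus.integral_mul_inner_gradient_add_eq_zero hut (hθ.divFree t ht) hg hθt
  have hC : ∫ x, g x * Torus.laplacian (θ t) x = ∫ x, θ t x * Torus.laplacian g x := by
    rw [Torus.integral_mul_laplacian_comm_holds hg hθt]
    exact integral_congr_ae (Eventually.of_forall fun x => mul_comm _ _)
  have hB' : ∫ x, g x * ⟪u t x, Torus.gradient (θ t) x⟫_ℝ =
      -∫ x, θ t x * ⟪u t x, Torus.gradient g x⟫_ℝ := by
    have hcomm : (fun x => ⟪u t x, Torus.gradient g x⟫_ℝ * θ t x) =
        fun x => θ t x * ⟪u t x, Torus.gradient g x⟫_ℝ := funext fun x => mul_comm _ _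
    rw [hcomm] at hB
    linarith
  have hfun : (fun x => θ t x * (⟪u t x, Torus.gradient g x⟫_ℝ + κ * Torus.laplacian g x)) =
      fun x => θ t x * ⟪u t x, Torus.gradient g x⟫_ℝ + κ * (θ t x * Torus.laplacian g x) := by
    funext x
    ring
  rw [hpt, hfun, integral_sub (i1.const_mul κ) i2, integral_const_mul, integral_add j1 j2,
    integral_const_mul, hC, hB']
  ring

omit [DecidableEq d] in
/-- **Cauchy–Schwarz, two-sided**: `|∫ f g| ≤ (∫ f²)^{1/2} (∫ g²)^{1/2}` in `L²(T^d)`. [folklore] -/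
theorem abs_integral_mul_le {f g : UnitAddTorus d → ℝ} (hf : MemLp f 2 volume)
    (hg : MemLp g 2 volume) :
    |∫ x, f x * g x| ≤ √(∫ x, f x ^ 2) * √(∫ x, g x ^ 2) := by
  have h1 := integral_mul_le_sqrt_mul_sqrt hf hg
  have h2 := integral_mul_le_sqrt_mul_sqrt hf.neg hg
  have hneg : ∫ x, (-f) x * g x = -∫ x, f x * g x := by
    rw [← integral_neg]
    exact integral_congr_ae (Eventually.of_forall fun x => by simp [neg_mul])
  have hsq : (fun x => (-f) x ^ 2) = fun x => f x ^ 2 := funext fun x => by simp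
  rw [hneg, hsq] at h2
  exact abs_le.2 ⟨by linarith, h1⟩

omit [DecidableEq d] in
/-- A pointwise-in-mean-square bound turns Cauchy–Schwarz into
`|∫ θ g| ≤ ‖θ‖_{L²} G` whenever `∫ g² ≤ G²`, `G ≥ 0`. [folklore] -/
theorem abs_integral_mul_le_of_sq_le {θ g : UnitAddTorus d → ℝ} (hθ : Torus.IsSmooth θ)
    (hg : MemLp g 2 volume) {G : ℝ} (hG : 0 ≤ G) (hgG : ∫ x, g x ^ 2 ≤ G ^ 2) :
    |∫ x, θ x * g x| ≤ √(Torus.scalarL2Sq θ) * G := by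
  have h := abs_integral_mul_le (hθ.memLp 2) hg
  have hsqrt : √(∫ x, g x ^ 2) ≤ G := by
    rw [← Real.sqrt_sq hG]
    exact Real.sqrt_le_sqrt hgG
  exact h.trans (mul_le_mul_of_nonneg_left hsqrt (Real.sqrt_nonneg _))

/-- **Lipschitz bound of the pairing.** For a classical solution `θ` on `[m, ∞)` (`κ ≥ 0`), a
smooth steady `g` and `G ≥ 0` with `∫ (⟪u(τ), ∇g⟫ + κΔg)² ≤ G²` for `τ ∈ [m, R]`, the pairing
`t ↦ ∫ g θ(t)` is `‖θ(m)‖_{L²} G`-Lipschitz on `[m, R]` (mean value inequality with the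
derivative `∫ θ (⟪u, ∇g⟫ + κΔg)`, Cauchy–Schwarz, and `‖θ(τ)‖ ≤ ‖θ(m)‖`). [folklore] -/
theorem abs_integral_mul_sub_le {κ : ℝ} {u : ℝ → UnitAddTorus d → EuclideanSpace ℝ d}
    {θ : ℝ → UnitAddTorus d → ℝ} {g : UnitAddTorus d → ℝ} {m R G : ℝ} (hκ : 0 ≤ κ)
    (hθ : Torus.IsClassicalScalarTransportOn (Ici m) κ u θ) (hg : Torus.IsSmooth g) (hG : 0 ≤ G)
    (hbound : ∀ τ ∈ Icc m R,
      ∫ x, (⟪u τ x, Torus.gradient g x⟫_ℝ + κ * Torus.laplacian g x) ^ 2 ≤ G ^ 2)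
    {t t' : ℝ} (ht : t ∈ Icc m R) (ht' : t' ∈ Icc m R) :
    |(∫ x, g x * θ t' x) - ∫ x, g x * θ t x| ≤ √(Torus.scalarL2Sq (θ m)) * G * |t' - t| := by
  have hderiv : ∀ τ ∈ Icc m R, HasDerivWithinAt (fun τ => ∫ x, g x * θ τ x)
      (∫ x, θ τ x * (⟪u τ x, Torus.gradient g x⟫_ℝ + κ * Torus.laplacian g x)) (Icc m R) τ :=
    fun τ hτ => (hasDerivWithinAt_integral_mul hθ (convex_Ici m) (uniqueDiffOn_Ici m) hg
      (mem_Ici.2 hτ.1)).mono Icc_subset_Ici_self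
  have hbd : ∀ τ ∈ Icc m R,
      ‖∫ x, θ τ x * (⟪u τ x, Torus.gradient g x⟫_ℝ + κ * Torus.laplacian g x)‖ ≤
        √(Torus.scalarL2Sq (θ m)) * G := by
    intro τ hτ
    have hτ' : τ ∈ Ici m := mem_Ici.2 hτ.1
    have hθτ : Torus.IsSmooth (θ τ) := hθ.smooth_scalar.isSmooth_slice hτ'
    have huτ : Torus.IsSmooth (u τ) := hθ.smooth_velocity.isSmooth_slice hτ'
    have hgτ : Torus.IsSmooth (fun x => ⟪u τ x, Torus.gradient g x⟫_ℝ + κ * Torus.laplacian g x) :=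
      (huτ.inner hg.gradient).add ((Torus.isSmooth_const κ).smul' hg.laplacian)
    have h1 := abs_integral_mul_le_of_sq_le hθτ (hgτ.memLp 2) hG (hbound τ hτ)
    have hanti := hθ.antitoneOn_scalarL2Sq hκ (a := m) (b := τ) Icc_subset_Ici_self
    have hdec : Torus.scalarL2Sq (θ τ) ≤ Torus.scalarL2Sq (θ m) :=
      hanti (left_mem_Icc.2 hτ.1) (right_mem_Icc.2 hτ.1) hτ.1
    rw [Real.norm_eq_abs]
    exact h1.trans (mul_le_mul_of_nonneg_right (Real.sqrt_le_sqrt hdec) hG)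
  have h := (convex_Icc m R).norm_image_sub_le_of_norm_hasDerivWithin_le hderiv hbd ht ht'
  simpa only [Real.norm_eq_abs] using h

/-- **Releases at nearby times stay `L²`-close.** For classical releases `φ s` of `h`
(`s ≥ 0`, `κ ≥ 0`) and `0 ≤ s ≤ s' ≤ t`,
`∫ (φ_s(t) - φ_{s'}(t))² ≤ 2 (∫ h² - ∫ h φ_s(s'))`: the difference is a classical solution on
`[s', ∞)` issued from `φ_s(s') - h`, its `L²` norm decays, and
`‖φ_s(s') - h‖² = ‖φ_s(s')‖² - 2⟨h, φ_s(s')⟩ + ‖h‖² ≤ 2(‖h‖² - ⟨h, φ_s(s')⟩)`. [folklore] -/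
theorem integral_release_sub_sq_le {κ : ℝ} {u : ℝ → UnitAddTorus d → EuclideanSpace ℝ d}
    {h : UnitAddTorus d → ℝ} {φ : ℝ → ℝ → UnitAddTorus d → ℝ} (hκ : 0 ≤ κ)
    (hh : Torus.IsSmooth h)
    (hφ : ∀ s, 0 ≤ s → Torus.IsClassicalScalarTransportOn (Ici s) κ u (φ s) ∧ φ s s = h)
    {s s' t : ℝ} (hs : 0 ≤ s) (hss' : s ≤ s') (hs't : s' ≤ t) :
    ∫ x, (φ s t x - φ s' t x) ^ 2 ≤ 2 * ((∫ x, h x * h x) - ∫ x, h x * φ s s' x) := by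
  have hs' : 0 ≤ s' := hs.trans hss'
  obtain ⟨hφs, hφss⟩ := hφ s hs
  obtain ⟨hφs', hφs's'⟩ := hφ s' hs'
  have hU : UniqueDiffOn ℝ (Ici s') := uniqueDiffOn_Ici s'
  have hψ : Torus.IsClassicalScalarTransportOn (Ici s') κ u (fun τ x => φ s τ x - φ s' τ x) :=
    unforced_sub hU (hφs.restrict (Ici_subset_Ici.2 hss') hU) hφs'
  have hanti := hψ.antitoneOn_scalarL2Sq hκ (a := s') (b := t) Icc_subset_Ici_self
  have hdec : Torus.scalarL2Sq (fun x => φ s t x - φ s' t x) ≤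
      Torus.scalarL2Sq (fun x => φ s s' x - φ s' s' x) :=
    hanti (left_mem_Icc.2 hs't) (right_mem_Icc.2 hs't) hs't
  simp only [Torus.scalarL2Sq, hφs's'] at hdec
  refine hdec.trans ?_
  -- `‖φ_s(s')‖² ≤ ‖φ_s(s)‖² = ‖h‖²`
  have hanti' := hφs.antitoneOn_scalarL2Sq hκ (a := s) (b := s') Icc_subset_Ici_self
  have hdec' : Torus.scalarL2Sq (φ s s') ≤ Torus.scalarL2Sq (φ s s) :=
    hanti' (left_mem_Icc.2 hss') (right_mem_Icc.2 hss') hss'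
  simp only [Torus.scalarL2Sq, hφss] at hdec'
  -- expand the square
  have hsl : Torus.IsSmooth (φ s s') := hφs.smooth_scalar.isSmooth_slice (mem_Ici.2 hss')
  have hhc : Continuous h := hh.continuous
  have hpc : Continuous (φ s s') := hsl.continuous
  have i1 : Integrable (fun x => φ s s' x ^ 2) volume := (hpc.pow 2).integrable_unitAddTorus
  have i2 : Integrable (fun x => 2 * (h x * φ s s' x)) volume :=
    (continuous_const.mul (hhc.mul hpc)).integrable_unitAddTorus
  have i3 : Integrable (fun x => h x ^ 2) volume := (hhc.pow 2).integrable_unitAddTorus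
  have hexp : ∫ x, (φ s s' x - h x) ^ 2 =
      (∫ x, φ s s' x ^ 2) - 2 * (∫ x, h x * φ s s' x) + ∫ x, h x ^ 2 := by
    have e : ∀ x, (φ s s' x - h x) ^ 2 = (φ s s' x ^ 2 - 2 * (h x * φ s s' x)) + h x ^ 2 :=
      fun x => by ring
    have i12 : Integrable (fun x => φ s s' x ^ 2 - 2 * (h x * φ s s' x)) volume := i1.sub i2
    simp_rw [e]
    rw [integral_add i12 i3, integral_sub i1 i2, integral_const_mul]
  have hh2 : ∫ x, h x * h x = ∫ x, h x ^ 2 := integral_congr_ae (Eventually.of_forall fun x => by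
    simp [sq])
  rw [hexp, hh2]
  linarith

end ReleaseKernel

open Literature.Analysis.FunctionSpaces Literature.Analysis.FluidPDE in
/-- **F2.** Joint continuity of the padded classical release kernel: if `φ s` (`s ≥ 0`) is the
classical solution of `∂ₜφ + u·∇φ = κΔφ` on `[s, ∞)` released from the smooth profile `h` at
time `s`, with `u` jointly smooth on `[0, ∞) × T²`, then
`(t, s) ↦ ∫ h · φ_{s⁺}(t ∨ s⁺)` (`s⁺ = s ∨ 0`) is continuous on `ℝ²`. On `D = {0 ≤ s ≤ t}` the
kernel obeys `|k(t,s) - k(t₀,s₀)| ≤ L|t - t₀| + 2‖h‖√(2L|s - s₀|)` locally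
(`ReleaseKernel.abs_integral_mul_sub_le`, `ReleaseKernel.integral_release_sub_sq_le`,
Cauchy–Schwarz), and the padding is a continuous retraction onto `D`. [folklore] -/
theorem stub_releaseKernelContinuous (κ : ℝ)
    (u : ℝ → UnitAddTorus (Fin 2) → EuclideanSpace ℝ (Fin 2))
    (h : UnitAddTorus (Fin 2) → ℝ) (φ : ℝ → ℝ → UnitAddTorus (Fin 2) → ℝ) (hκ : 0 < κ)
    (hu : Literature.Analysis.FunctionSpaces.Torus.IsSmoothSpaceTimeOn (Ici (0 : ℝ)) u)
    (hh : Literature.Analysis.FunctionSpaces.Torus.IsSmooth h)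
    (hφ : ∀ s, 0 ≤ s →
      Literature.Analysis.FluidPDE.Torus.IsClassicalScalarTransportOn (Ici s) κ u (φ s) ∧ φ s s = h) :
    Continuous (fun p : ℝ × ℝ => ∫ x, h x * φ (max p.2 0) (max p.1 (max p.2 0)) x) := by
  -- the kernel on `D = {0 ≤ s ≤ t}` (first coordinate: observation time, second: release time)
  set K : ℝ × ℝ → ℝ := fun q => ∫ x, h x * φ q.2 q.1 x with hK_def
  set D : Set (ℝ × ℝ) := {q | 0 ≤ q.2 ∧ q.2 ≤ q.1} with hD_def
  -- the steady test field `w(τ) = ⟪u(τ), ∇h⟫ + κΔh`, jointly smooth on `[0, ∞)`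
  set w : ℝ → UnitAddTorus (Fin 2) → ℝ := fun τ x =>
    ⟪u τ x, Torus.gradient h x⟫_ℝ + κ * Torus.laplacian h x with hw_def
  have hw : Torus.IsSmoothSpaceTimeOn (Ici (0 : ℝ)) w :=
    (hu.inner (Torus.isSmoothSpaceTimeOn_const hh.gradient _)).add
      (Torus.isSmoothSpaceTimeOn_const ((Torus.isSmooth_const κ).smul' hh.laplacian) _)
  have hH : 0 ≤ √(Torus.scalarL2Sq h) := Real.sqrt_nonneg _
  have hhh : ∫ x, h x * h x = Torus.scalarL2Sq h := by
    simp only [Torus.scalarL2Sq]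
    exact integral_congr_ae (Eventually.of_forall fun x => by simp [sq])
  have hKD : ContinuousOn K D := by
    rintro ⟨t₀, s₀⟩ ⟨hs₀, hst₀⟩
    simp only at hs₀ hst₀
    set R : ℝ := t₀ + 1 with hR_def
    -- a uniform bound `∫ w(τ)² ≤ G²` on `[0, R]`
    obtain ⟨C, hC⟩ :=
      hw.exists_norm_le_of_isCompact isCompact_Icc (Icc_subset_Ici_self : Icc 0 R ⊆ Ici 0)
    set G : ℝ := max C 0 with hG_def
    have hG : 0 ≤ G := le_max_right _ _
    have hwG : ∀ τ ∈ Icc 0 R, ∫ x, w τ x ^ 2 ≤ G ^ 2 := by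
      intro τ hτ
      have hpt : ∀ x, w τ x ^ 2 ≤ G ^ 2 := fun x => by
        have h1 : |w τ x| ≤ G := ((Real.norm_eq_abs _).symm.le.trans (hC τ hτ x)).trans
          (le_max_left _ _)
        have h2 := pow_le_pow_left₀ (abs_nonneg _) h1 2
        rwa [sq_abs] at h2
      have hwc : Torus.IsSmooth (w τ) := hw.isSmooth_slice (mem_Ici.2 hτ.1)
      calc ∫ x, w τ x ^ 2 ≤ ∫ _, G ^ 2 :=
            integral_mono ((hwc.continuous.pow 2).integrable_unitAddTorus) (integrable_const _) hpt
        _ = G ^ 2 := by simp [integral_const]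
    -- the Lipschitz constant in the observation time, uniform in the release time
    set L : ℝ := √(Torus.scalarL2Sq h) * G with hL_def
    have hL : 0 ≤ L := mul_nonneg hH hG
    -- (a) Lipschitz in the observation time for the release at `m ≥ 0`
    have hlip : ∀ m, 0 ≤ m → ∀ t t', t ∈ Icc m R → t' ∈ Icc m R →
        |K (t', m) - K (t, m)| ≤ L * |t' - t| := by
      intro m hm t t' ht ht'
      obtain ⟨hφm, hφmm⟩ := hφ m hm
      have hb : ∀ τ ∈ Icc m R,
          ∫ x, (⟪u τ x, Torus.gradient h x⟫_ℝ + κ * Torus.laplacian h x) ^ 2 ≤ G ^ 2 :=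
        fun τ hτ => hwG τ ⟨hm.trans hτ.1, hτ.2⟩
      have h1 := ReleaseKernel.abs_integral_mul_sub_le hκ.le hφm hh hG hb ht ht'
      rwa [hφmm] at h1
    -- (b) continuity in the release time: `m ≤ s ≤ t ≤ R`
    have hrel : ∀ m s t, 0 ≤ m → m ≤ s → s ≤ t → t ≤ R →
        |K (t, s) - K (t, m)| ≤ √(Torus.scalarL2Sq h) * √(2 * L * (s - m)) := by
      intro m s t hm hms hst htR
      have hsq := ReleaseKernel.integral_release_sub_sq_le hκ.le hh hφ hm hms hst
      have hmR : m ∈ Icc m R := ⟨le_rfl, hms.trans (hst.trans htR)⟩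
      have hsR : s ∈ Icc m R := ⟨hms, hst.trans htR⟩
      have hKmm : K (m, m) = Torus.scalarL2Sq h := by
        simp only [hK_def, (hφ m hm).2]
        exact hhh
      have hl' : Torus.scalarL2Sq h - K (s, m) ≤ L * (s - m) := by
        have hl : |K (m, m) - K (s, m)| ≤ L * |m - s| := hlip m hm s m hsR hmR
        rw [hKmm, abs_sub_comm m s, abs_of_nonneg (sub_nonneg.2 hms)] at hl
        exact (le_abs_self _).trans hl
      have hsq' : ∫ x, (φ m t x - φ s t x) ^ 2 ≤ 2 * L * (s - m) := by
        refine hsq.trans ?_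
        rw [hhh]
        simp only [hK_def] at hl'
        nlinarith
      have hmt : t ∈ Ici m := mem_Ici.2 (hms.trans hst)
      have hst' : t ∈ Ici s := mem_Ici.2 hst
      have hφmt : Torus.IsSmooth (φ m t) := (hφ m hm).1.smooth_scalar.isSmooth_slice hmt
      have hφst : Torus.IsSmooth (φ s t) :=
        (hφ s (hm.trans hms)).1.smooth_scalar.isSmooth_slice hst'
      have i1 : Integrable (fun x => h x * φ s t x) volume := (hh.smul' hφst).integrable
      have i2 : Integrable (fun x => h x * φ m t x) volume := (hh.smul' hφmt).integrable
      have hdiff : K (t, s) - K (t, m) = -∫ x, h x * (φ m t x - φ s t x) := by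
        simp only [hK_def]
        rw [← integral_sub i1 i2, ← integral_neg]
        exact integral_congr_ae (Eventually.of_forall fun x => by ring)
      rw [hdiff, abs_neg]
      have hcs := ReleaseKernel.abs_integral_mul_le (hh.memLp 2) ((hφmt.sub hφst).memLp 2)
      simp only [Pi.sub_apply] at hcs
      refine hcs.trans (mul_le_mul_of_nonneg_left (Real.sqrt_le_sqrt hsq') hH)
    -- (c) assemble: squeeze against a continuous majorant vanishing at `(t₀, s₀)`
    set B : ℝ × ℝ → ℝ := fun q =>
      L * |q.1 - t₀| + 2 * (√(Torus.scalarL2Sq h) * √(2 * L * |q.2 - s₀|)) with hB_def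
    have hBc : Continuous B := by
      simp only [hB_def]
      fun_prop
    have hB0 : B (t₀, s₀) = 0 := by simp [hB_def]
    have hBt : Tendsto B (𝓝[D] (t₀, s₀)) (𝓝 0) := by
      have h1 := hBc.tendsto (t₀, s₀)
      rw [hB0] at h1
      exact h1.mono_left nhdsWithin_le_nhds
    have hev : ∀ᶠ q in 𝓝[D] (t₀, s₀), ‖K q - K (t₀, s₀)‖ ≤ B q := by
      have h1 : ∀ᶠ q : ℝ × ℝ in 𝓝 (t₀, s₀), q.1 < R :=
        (continuous_fst.tendsto (t₀, s₀)).eventually (eventually_lt_nhds (lt_add_one t₀))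
      filter_upwards [eventually_nhdsWithin_of_eventually_nhds h1,
        eventually_mem_nhdsWithin] with q hqR hqD
      obtain ⟨t, s⟩ := q
      obtain ⟨hs, hst⟩ := hqD
      simp only at hs hst hqR ⊢
      have htR : t ≤ R := hqR.le
      have ht₀R : t₀ ≤ R := (lt_add_one t₀).le
      set m : ℝ := min s s₀ with hm_def
      have hm : 0 ≤ m := le_min hs hs₀
      have hms : m ≤ s := min_le_left _ _
      have hms₀ : m ≤ s₀ := min_le_right _ _
      have e1 := hrel m s t hm hms hst htR
      have e2 := hlip m hm t₀ t ⟨hms₀.trans hst₀, ht₀R⟩ ⟨hms.trans hst, htR⟩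
      have e3 := hrel m s₀ t₀ hm hms₀ hst₀ ht₀R
      have hsm : s - m ≤ |s - s₀| := by
        rcases le_total s s₀ with hle | hle
        · rw [hm_def, min_eq_left hle, sub_self]; exact abs_nonneg _
        · rw [hm_def, min_eq_right hle]; exact le_abs_self _
      have hs₀m : s₀ - m ≤ |s - s₀| := by
        rcases le_total s s₀ with hle | hle
        · rw [hm_def, min_eq_left hle, abs_sub_comm]; exact le_abs_self _
        · rw [hm_def, min_eq_right hle, sub_self]; exact abs_nonneg _
      have f1 : √(2 * L * (s - m)) ≤ √(2 * L * |s - s₀|) :=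
        Real.sqrt_le_sqrt (mul_le_mul_of_nonneg_left hsm (by positivity))
      have f3 : √(2 * L * (s₀ - m)) ≤ √(2 * L * |s - s₀|) :=
        Real.sqrt_le_sqrt (mul_le_mul_of_nonneg_left hs₀m (by positivity))
      have htri : |K (t, s) - K (t₀, s₀)| ≤
          |K (t, s) - K (t, m)| + |K (t, m) - K (t₀, m)| + |K (t₀, s₀) - K (t₀, m)| := by
        have := abs_sub_le (K (t, s)) (K (t, m)) (K (t₀, s₀))
        have := abs_sub_le (K (t, m)) (K (t₀, m)) (K (t₀, s₀))
        have := abs_sub_comm (K (t₀, m)) (K (t₀, s₀))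
        linarith
      rw [Real.norm_eq_abs]
      simp only [hB_def]
      have g1 := mul_le_mul_of_nonneg_left f1 hH
      have g3 := mul_le_mul_of_nonneg_left f3 hH
      linarith
    have hT : Tendsto (fun q => K q - K (t₀, s₀)) (𝓝[D] (t₀, s₀)) (𝓝 0) :=
      squeeze_zero_norm' hev hBt
    exact tendsto_sub_nhds_zero_iff.1 hT
  -- the padding `(t, s) ↦ (t ∨ s⁺, s⁺)` is a continuous retraction onto `D`
  have hr : Continuous fun p : ℝ × ℝ => (max p.1 (max p.2 0), max p.2 0) := by fun_prop
  have hmem : ∀ p : ℝ × ℝ, (max p.1 (max p.2 0), max p.2 0) ∈ D := fun p =>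
    ⟨le_max_right _ _, le_max_right _ _⟩
  exact hKD.comp_continuous hr hmem

end Summit.AnomalousDissipation.AnomalousDissipation.Theorems.FloorUpgradeLine

end
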